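import Summits.CriticalPhenomena.PercolationContinuityZ3.Theorems.PercNearOneGluingNoHeavyLowerTailSahiGridPatternLiteralOrIdentity
import Summits.CriticalPhenomena.PercolationContinuityZ3.Theorems.PercNearOneGluingNoHeavyLowerTailSahiGridPatternTwoPayerSections

/-!
# `NoHeavyLowerTail` (crux stmt-CriticalPhenomena-4575), Sahi programme P1: **THE TWO-PAYER OR STAR ON THE CROSSED FAMILY — A LATIN TRIPLE COUNT**

Support file (Sahi cell, seat `prim-sahi-p1`, generation 37; `--supports stmt-CriticalPhenomena-4575`).  Pure proofs, no definitions, no `sorry`, standard axioms.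
Vocabulary of `…SahiGridPattern{,SliceForm,CellForm,DiagCert,LiteralOrIdentity,TwoPayerSections}` (`Pd`, `ind`, `TotDist`, `thirdPt`, `pairSum_eq_of_sym6_eq`).

THE MATHEMATICS (seat memo FROM-prim-sahi-p1-gen37-CROSSED-FAMILY-TRIPLE-COUNT §1–§2).  `U = (x∧y) ∨ V ⊆ [3]^{2+k}` is the two-payer OR star with the OR8 vector `e` (`4·2^k·1_V` on the cell `00`,
`(2·2^k+2d)·1_V` on the four cells `0j, i0` (`i,j ≥ 1`), `4·2^k+3h_V` on the four T-cells), `d` a certificate of the up-set `V ⊆ [3]^k`.  Generation 36 found that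
condition (N) `Θ_U(B×C) ≤ e(B∩C)` has NO proof by one identity with constant multipliers; this file proves (N) on the CROSSED FAMILY
`B ⊇ {x ≥ 1}`, `C ⊇ {y ≥ 1}` — exactly the configurations on which the crossed ("T1-type") cover fails — by the "top" cover and ONE new nonnegative
quantity, a COUNT OF LATIN TRIPLES.  Writing `P_j = B_{(0,j)}`, `Q_i = C_{(i,0)}` (`j, i ∈ {0,1,2}`, `P_0 ⊆ P_1 ⊆ P_2`, `Q_0 ⊆ Q_1 ⊆ Q_2`; all other sections are `[3]^k`):
  `e(B∩C) − Θ_U(B×C) = Σ_{c,r ∈ {1,2}} ( N_V[⊤, P_c ∪ Q_r] + N_V[P_c, Q_r] + #{(q,r',p) Latin : q ∉ P_c, r' ∉ Q_r, p ∉ V} )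
                        + 2^k Σ_{q ∈ V} [ 4(1−1_{P_0})(1−1_{Q_0}) − (2−1_{P_1}−1_{P_2})(2−1_{Q_1}−1_{Q_2}) ](q)`,
`N_V[X,Z] = d(X∩Z) − Θ_V(X×Z) ≥ 0` being condition (N) of the certificate of `V`.  **THEOREMS:** `twoPayerCrossed_pair_identity` (the identity behind this, as an
equality of pair sums for ARBITRARY integer functions `P_0,P_1,P_2,Q_0,Q_1,Q_2,V` — `pairSum_eq_of_sym6_eq` + `ring`), `twoPayerCrossed_columns_nonneg`
(its right-hand side is `≥ 0` for nested indicator functions).  In the sub-case `P_0=P_1=P_2=P`, `Q_i = Q` the d-free part is the single count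
`4·#{(q,r,p) Latin : q ∉ P, r ∉ Q, p ∉ V}` (memo §1).  Nothing here asserts `PatternPos d` for `d ≥ 4` or condition (N) beyond this family. [this work]
-/

namespace Summit.CriticalPhenomena.PercolationContinuityZ3.Theorems.SahiGridPattern

open Finset SahiGrid3
open scoped BigOperators

variable {k : ℕ}

/-- **The crossed-family identity for the two-payer OR star, pair-sum form, ARBITRARY integer functions** `P₀ P₁ P₂ Q₀ Q₁ Q₂ V : [3]^k → ℤ`:
the kernel "d-free budget − Θ_U + the Θ-terms of the top cover `Σ_{c,r}(Θ_V(⊤×(P_c∪Q_r)) + Θ_V(P_c×Q_r))`" and the kernel "four Latin triple products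
`(1−P_c(q))(1−Q_r(r))(1−V(q̄r))` + the pointwise form `V(q)[4(1−P₀)(1−Q₀) − (2−P₁−P₂)(2−Q₁−Q₂)](q)`" have the same sum over totally distinct pairs. [this work] -/
theorem twoPayerCrossed_pair_identity (P0 P1 P2 Q0 Q1 Q2 V : Pd k → ℤ) :
    (∑ q : Pd k, ∑ r : Pd k, (if TotDist q r = true then (1:ℤ) else 0) *
      ( (P0 q * Q0 q * (4 * V q) + P1 q * (2 * V q) + P2 q * (2 * V q) + Q1 q * (2 * V q) + Q2 q * (2 * V q) + 4 * (4 + 3 * V q - 3 * V r))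
        - (P0 q * (V q)
          + P0 q * (V q)
          + P0 q * (V q)
          + P0 q * (V q)
          + P1 q * Q1 r * (V q + V r - 1)
          + P1 q * (V q + 1 - V (thirdPt q r))
          + P1 q * Q2 r * (V q + V r - 1)
          + P1 q * (V q + 1 - V (thirdPt q r))
          + P2 q * Q1 r * (V q + V r - 1)
          + P2 q * (V q + 1 - V (thirdPt q r))
          + P2 q * Q2 r * (V q + V r - 1)
          + P2 q * (V q + 1 - V (thirdPt q r))
          + 1 * (V q + V r - 1)
          + 1 * (V q + V r - 1)
          + 1 * (V q + 1 - V (thirdPt q r))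
          + 1 * (V q + 1 - V (thirdPt q r))
          + Q0 r * (V r)
          + 1 * (1 + V r - V (thirdPt q r))
          + Q2 r * (1 + V r - V (thirdPt q r))
          + 1 * (2 - V (thirdPt q r))
          + Q0 r * (V r)
          + 1 * (1 + V r - V (thirdPt q r))
          + Q2 r * (1 + V r - V (thirdPt q r))
          + 1 * (2 - V (thirdPt q r))
          + 1 * (V q + V r - 1)
          + 1 * (V q + V r - 1)
          + 1 * (V q + 1 - V (thirdPt q r))
          + 1 * (V q + 1 - V (thirdPt q r))
          + Q0 r * (V r)
          + 1 * (1 + V r - V (thirdPt q r))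
          + Q1 r * (1 + V r - V (thirdPt q r))
          + 1 * (2 - V (thirdPt q r))
          + Q0 r * (V r)
          + 1 * (1 + V r - V (thirdPt q r))
          + Q1 r * (1 + V r - V (thirdPt q r))
          + 1 * (2 - V (thirdPt q r)))
        + ((V q + V r - V (thirdPt q r)) * (P1 r + Q1 r - P1 r * Q1 r)
          + P1 q * Q1 r * (V q + V r - V (thirdPt q r))
          + (V q + V r - V (thirdPt q r)) * (P1 r + Q2 r - P1 r * Q2 r)
          + P1 q * Q2 r * (V q + V r - V (thirdPt q r))
          + (V q + V r - V (thirdPt q r)) * (P2 r + Q1 r - P2 r * Q1 r)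
          + P2 q * Q1 r * (V q + V r - V (thirdPt q r))
          + (V q + V r - V (thirdPt q r)) * (P2 r + Q2 r - P2 r * Q2 r)
          + P2 q * Q2 r * (V q + V r - V (thirdPt q r))) ))
    = ∑ q : Pd k, ∑ r : Pd k, (if TotDist q r = true then (1:ℤ) else 0) *
      ( (1 - P1 q) * (1 - Q1 r) * (1 - V (thirdPt q r)) + (1 - P1 q) * (1 - Q2 r) * (1 - V (thirdPt q r)) + (1 - P2 q) * (1 - Q1 r) * (1 - V (thirdPt q r)) + (1 - P2 q) * (1 - Q2 r) * (1 - V (thirdPt q r)) + V q * (4 * (1 - P0 q) * (1 - Q0 q) - (2 - P1 q - P2 q) * (2 - Q1 q - Q2 q)) ) := by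
  obtain ⟨c1, c2, c3, c4⟩ := And.intro (fun q r => (thirdPt_cancel (k := k) q r).1) (And.intro (fun q r => (thirdPt_cancel (k := k) q r).2.1)
    (And.intro (fun q r => (thirdPt_cancel (k := k) q r).2.2.1) (fun q r => (thirdPt_cancel (k := k) q r).2.2.2)))
  exact pairSum_eq_of_sym6_eq _ _ (fun q r => by simp only [c1, c2, c3, c4, thirdPt_comm r q]; ring)

/-- **The right-hand side columns are nonnegative** for `[0,1]`-valued functions with `P₀ ≤ P₁`, `P₀ ≤ P₂`, `Q₀ ≤ Q₁`, `Q₀ ≤ Q₂` pointwise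
(four Latin triple counts and the pointwise form `4(1−P₀)(1−Q₀) ≥ (2−P₁−P₂)(2−Q₁−Q₂)`). [this work] -/
theorem twoPayerCrossed_columns_nonneg (P0 P1 P2 Q0 Q1 Q2 V : Pd k → ℤ)
    (hP1 : ∀ q, P1 q ≤ 1) (hP2 : ∀ q, P2 q ≤ 1) (hQ1 : ∀ q, Q1 q ≤ 1) (hQ2 : ∀ q, Q2 q ≤ 1)
    (hV0 : ∀ q, 0 ≤ V q) (hV1 : ∀ q, V q ≤ 1)
    (h01 : ∀ q, P0 q ≤ P1 q) (h02 : ∀ q, P0 q ≤ P2 q) (g01 : ∀ q, Q0 q ≤ Q1 q) (g02 : ∀ q, Q0 q ≤ Q2 q) :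
    0 ≤ ∑ q : Pd k, ∑ r : Pd k, (if TotDist q r = true then (1:ℤ) else 0) *
      ( (1 - P1 q) * (1 - Q1 r) * (1 - V (thirdPt q r)) + (1 - P1 q) * (1 - Q2 r) * (1 - V (thirdPt q r)) + (1 - P2 q) * (1 - Q1 r) * (1 - V (thirdPt q r)) + (1 - P2 q) * (1 - Q2 r) * (1 - V (thirdPt q r)) + V q * (4 * (1 - P0 q) * (1 - Q0 q) - (2 - P1 q - P2 q) * (2 - Q1 q - Q2 q)) ) := by
  refine Finset.sum_nonneg fun q _ => Finset.sum_nonneg fun r _ => mul_nonneg (by split_ifs <;> norm_num) ?_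
  have v3 : 0 ≤ 1 - V (thirdPt q r) := by linarith [hV1 (thirdPt q r)]
  have p1 : 0 ≤ 1 - P1 q := by linarith [hP1 q]
  have p2 : 0 ≤ 1 - P2 q := by linarith [hP2 q]
  have q1 : 0 ≤ 1 - Q1 r := by linarith [hQ1 r]
  have q2 : 0 ≤ 1 - Q2 r := by linarith [hQ2 r]
  have t1 : 0 ≤ (1 - P1 q) * (1 - Q1 r) * (1 - V (thirdPt q r)) := mul_nonneg (mul_nonneg p1 q1) v3
  have t2 : 0 ≤ (1 - P1 q) * (1 - Q2 r) * (1 - V (thirdPt q r)) := mul_nonneg (mul_nonneg p1 q2) v3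
  have t3 : 0 ≤ (1 - P2 q) * (1 - Q1 r) * (1 - V (thirdPt q r)) := mul_nonneg (mul_nonneg p2 q1) v3
  have t4 : 0 ≤ (1 - P2 q) * (1 - Q2 r) * (1 - V (thirdPt q r)) := mul_nonneg (mul_nonneg p2 q2) v3
  have u1 : 2 - P1 q - P2 q ≤ 2 * (1 - P0 q) := by linarith [h01 q, h02 q]
  have u2 : 2 - Q1 q - Q2 q ≤ 2 * (1 - Q0 q) := by linarith [g01 q, g02 q]
  have u3 : 0 ≤ 2 - Q1 q - Q2 q := by linarith [hQ1 q, hQ2 q]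
  have u4 : 0 ≤ 2 * (1 - P0 q) := by linarith [h01 q, hP1 q]
  have u5 : (2 - P1 q - P2 q) * (2 - Q1 q - Q2 q) ≤ (2 * (1 - P0 q)) * (2 * (1 - Q0 q)) := mul_le_mul u1 u2 u3 u4
  have t5 : 0 ≤ V q * (4 * (1 - P0 q) * (1 - Q0 q) - (2 - P1 q - P2 q) * (2 - Q1 q - Q2 q)) :=
    mul_nonneg (hV0 q) (by linarith [u5])
  linarith [t1, t2, t3, t4, t5]

/-! ### (N) for the two-payer OR star on the crossed family -/

/-- **(N) FOR THE TWO-PAYER OR STAR ON THE CROSSED FAMILY** (every `k`): `U = (x∧y) ∨ V`, `V` an up-set with a vector `d` supported on `V` satisfying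
condition (N) of `…DiagCert`; for all up-sets `B ⊇ {x ≥ 1}`, `C ⊇ {y ≥ 1}` of `[3]^{2+k}`: `Σ_{x∈B,y∈C} Θ_U(x,y) ≤ Σ_{x∈B∩C} e(x)` with `e` the OR8
two-payer vector of `…TwoPayerSections.budget_twoPayer_sections`.  Proof: the top cover `Σ_{c,r}(N_V[⊤,P_c∪Q_r] + N_V[P_c,Q_r])` for the
`d`-part and `twoPayerCrossed_pair_identity` + `twoPayerCrossed_columns_nonneg` for the rest. [this work] -/
theorem twoPayerCrossed_N {V : Finset (Pd k)} {U : Finset (Pd (1 + (1 + k)))}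
    (hU : ∀ (ξ η : Pd 1) (q : Pd k), glue ξ (glue η q) ∈ U ↔ ((1 ≤ ξ 0 ∧ 1 ≤ η 0) ∨ q ∈ V))
    (d : Pd k → ℤ) (hdV : ∀ q, q ∉ V → d q = 0)
    (hN : ∀ A A' : Finset (Pd k), IsUpperSet (A : Set (Pd k)) → IsUpperSet (A' : Set (Pd k)) →
      (∑ q ∈ A, ∑ r ∈ A', thetaVal V q r) ≤ ∑ q ∈ A ∩ A', d q)
    (B C : Finset (Pd (1 + (1 + k)))) (hB : IsUpperSet (B : Set (Pd (1 + (1 + k))))) (hC : IsUpperSet (C : Set (Pd (1 + (1 + k)))))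
    (hBx : ∀ (ξ η : Pd 1) (q : Pd k), 1 ≤ ξ 0 → glue ξ (glue η q) ∈ B) (hCy : ∀ (ξ η : Pd 1) (q : Pd k), 1 ≤ η 0 → glue ξ (glue η q) ∈ C) :
    (∑ x ∈ B, ∑ y ∈ C, thetaVal U x y) ≤ ∑ x ∈ B ∩ C, (fun x : Pd (1 + (1 + k)) =>
        if (1 ≤ freeOf x 0 ∧ 1 ≤ freeOf (cellOf x) 0) then (4 * 2 ^ k + 3 * (2 ^ k * ind V (cellOf (cellOf x)) - (nuCount V (cellOf (cellOf x)) : ℤ)))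
        else if (freeOf x 0 = 0 ∧ freeOf (cellOf x) 0 = 0) then 4 * 2 ^ k * ind V (cellOf (cellOf x))
        else (2 * 2 ^ k + 2 * d (cellOf (cellOf x))) * ind V (cellOf (cellOf x))) x := by
  have f12 : (1:Fin 3) ≤ 2 := by decide
  have b1 : ∀ (η : Pd 1) (q : Pd k), ind B (glue (fun _ => 1) (glue η q)) = 1 := fun η q => by
    unfold ind; rw [if_pos (hBx (fun _ => 1) η q le_rfl)]
  have b2 : ∀ (η : Pd 1) (q : Pd k), ind B (glue (fun _ => 2) (glue η q)) = 1 := fun η q => by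
    unfold ind; rw [if_pos (hBx (fun _ => 2) η q f12)]
  have c1 : ∀ (ξ : Pd 1) (q : Pd k), ind C (glue ξ (glue (fun _ => 1) q)) = 1 := fun ξ q => by
    unfold ind; rw [if_pos (hCy ξ (fun _ => 1) q le_rfl)]
  have c2 : ∀ (ξ : Pd 1) (q : Pd k), ind C (glue ξ (glue (fun _ => 2) q)) = 1 := fun ξ q => by
    unfold ind; rw [if_pos (hCy ξ (fun _ => 2) q f12)]
  rw [theta_twoPayer_sections hU B C, budget_twoPayer_sections V d B C]
  simp only [b1, b2, c1, c2, one_mul, mul_one]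
  -- (1) the budget: d-free pair part + d part
  have hE : (∑ q : Pd k, ( ind B (glue (fun _ => 0) (glue (fun _ => 0) q)) * ind C (glue (fun _ => 0) (glue (fun _ => 0) q)) * (4 * 2 ^ k * ind V q)
        + ind B (glue (fun _ => 0) (glue (fun _ => 1) q)) * ((2 * 2 ^ k + 2 * d q) * ind V q)
        + ind B (glue (fun _ => 0) (glue (fun _ => 2) q)) * ((2 * 2 ^ k + 2 * d q) * ind V q)
        + ind C (glue (fun _ => 1) (glue (fun _ => 0) q)) * ((2 * 2 ^ k + 2 * d q) * ind V q)
        + (4 * 2 ^ k + 3 * (2 ^ k * ind V q - (nuCount V q : ℤ)))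
        + (4 * 2 ^ k + 3 * (2 ^ k * ind V q - (nuCount V q : ℤ)))
        + ind C (glue (fun _ => 2) (glue (fun _ => 0) q)) * ((2 * 2 ^ k + 2 * d q) * ind V q)
        + (4 * 2 ^ k + 3 * (2 ^ k * ind V q - (nuCount V q : ℤ)))
        + (4 * 2 ^ k + 3 * (2 ^ k * ind V q - (nuCount V q : ℤ))) ))
      = (∑ q : Pd k, ∑ r : Pd k, (if TotDist q r = true then (1:ℤ) else 0) * ((4 * ind V q * ind B (glue (fun _ => 0) (glue (fun _ => 0) q)) * ind C (glue (fun _ => 0) (glue (fun _ => 0) q)) + 2 * ind V q * (ind B (glue (fun _ => 0) (glue (fun _ => 1) q)) + ind B (glue (fun _ => 0) (glue (fun _ => 2) q)) + ind C (glue (fun _ => 1) (glue (fun _ => 0) q)) + ind C (glue (fun _ => 2) (glue (fun _ => 0) q))) + 16 + 12 * ind V q) - 12 * ind V r)) + (∑ q : Pd k, 2 * d q * ind V q * (ind B (glue (fun _ => 0) (glue (fun _ => 1) q)) + ind B (glue (fun _ => 0) (glue (fun _ => 2) q)) + ind C (glue (fun _ => 1) (glue (fun _ => 0) q)) + ind C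 (glue (fun _ => 2) (glue (fun _ => 0) q)))) := by
    rw [← Finset.sum_add_distrib]
    refine Finset.sum_congr rfl fun q _ => ?_
    have h2 : (∑ r : Pd k, (if TotDist q r = true then (1:ℤ) else 0) * ((4 * ind V q * ind B (glue (fun _ => 0) (glue (fun _ => 0) q)) * ind C (glue (fun _ => 0) (glue (fun _ => 0) q)) + 2 * ind V q * (ind B (glue (fun _ => 0) (glue (fun _ => 1) q)) + ind B (glue (fun _ => 0) (glue (fun _ => 2) q)) + ind C (glue (fun _ => 1) (glue (fun _ => 0) q)) + ind C (glue (fun _ => 2) (glue (fun _ => 0) q))) + 16 + 12 * ind V q) - 12 * ind V r))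
        = 2 ^ k * (4 * ind V q * ind B (glue (fun _ => 0) (glue (fun _ => 0) q)) * ind C (glue (fun _ => 0) (glue (fun _ => 0) q)) + 2 * ind V q * (ind B (glue (fun _ => 0) (glue (fun _ => 1) q)) + ind B (glue (fun _ => 0) (glue (fun _ => 2) q)) + ind C (glue (fun _ => 1) (glue (fun _ => 0) q)) + ind C (glue (fun _ => 2) (glue (fun _ => 0) q))) + 16 + 12 * ind V q) - (nuCount V q : ℤ) * 12 := by
      rw [show (∑ r : Pd k, (if TotDist q r = true then (1:ℤ) else 0) * ((4 * ind V q * ind B (glue (fun _ => 0) (glue (fun _ => 0) q)) * ind C (glue (fun _ => 0) (glue (fun _ => 0) q)) + 2 * ind V q * (ind B (glue (fun _ => 0) (glue (fun _ => 1) q)) + ind B (glue (fun _ => 0) (glue (fun _ => 2) q)) + ind C (glue (fun _ => 1) (glue (fun _ => 0) q)) + ind C (glue (fun _ => 2) (glue (fun _ => 0) q))) + 16 + 12 * ind V q) - 12 * ind V r))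
          = (∑ r : Pd k, (if TotDist q r = true then (1:ℤ) else 0) * (4 * ind V q * ind B (glue (fun _ => 0) (glue (fun _ => 0) q)) * ind C (glue (fun _ => 0) (glue (fun _ => 0) q)) + 2 * ind V q * (ind B (glue (fun _ => 0) (glue (fun _ => 1) q)) + ind B (glue (fun _ => 0) (glue (fun _ => 2) q)) + ind C (glue (fun _ => 1) (glue (fun _ => 0) q)) + ind C (glue (fun _ => 2) (glue (fun _ => 0) q))) + 16 + 12 * ind V q)) - ∑ r : Pd k, (if TotDist q r = true then (1:ℤ) else 0) * (ind V r * 12) by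
            rw [← Finset.sum_sub_distrib]; exact Finset.sum_congr rfl fun r _ => by ring]
      rw [← Finset.sum_mul, sum_ite_totDist_eq_two_pow, ← nuCount_mul_eq_pairSum V (fun _ => (12:ℤ)) q]
    rw [h2]
    ring
  -- (2) the sections P_c = B_(0,c), Q_r = C_(r,0) as finsets of [3]^k
  have hPind : ∀ (c : Fin 3) (q : Pd k), ind (sect (sect B (fun _ : Fin 1 => (0:Fin 3))) (fun _ : Fin 1 => c)) q
      = ind B (glue (fun _ => 0) (glue (fun _ => c) q)) := fun c q => by rw [ind_sect, ind_sect]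
  have hQind : ∀ (r : Fin 3) (q : Pd k), ind (sect (sect C (fun _ : Fin 1 => r)) (fun _ : Fin 1 => (0:Fin 3))) q
      = ind C (glue (fun _ => r) (glue (fun _ => 0) q)) := fun r q => by rw [ind_sect, ind_sect]
  have hPup : ∀ c : Fin 3, IsUpperSet ((sect (sect B (fun _ : Fin 1 => (0:Fin 3))) (fun _ : Fin 1 => c) : Finset (Pd k)) : Set (Pd k)) :=
    fun c => isUpperSet_sect (isUpperSet_sect hB _) _
  have hQup : ∀ r : Fin 3, IsUpperSet ((sect (sect C (fun _ : Fin 1 => r)) (fun _ : Fin 1 => (0:Fin 3)) : Finset (Pd k)) : Set (Pd k)) :=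
    fun r => isUpperSet_sect (isUpperSet_sect hC _) _
  have hdv2 : ∀ q : Pd k, 2 * d q * ind V q = 2 * d q := fun q => by
    unfold ind
    by_cases hq : q ∈ V
    · rw [if_pos hq, mul_one]
    · rw [if_neg hq, mul_zero, hdV q hq, mul_zero]
  have huniv : IsUpperSet ((Finset.univ : Finset (Pd k)) : Set (Pd k)) := by
    rw [Finset.coe_univ]; exact isUpperSet_univ
  -- (3) the top cover, one (c,r) at a time: d(P_c) + d(Q_r) ≥ Θ_V(⊤ × (P_c ∪ Q_r)) + Θ_V(P_c × Q_r)
  have cover : ∀ (c r : Fin 3),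
      (∑ q : Pd k, ∑ r' : Pd k, (if TotDist q r' = true then (1:ℤ) else 0) * ((ind V q + ind V r' - ind V (thirdPt q r'))
          * (ind B (glue (fun _ => 0) (glue (fun _ => c) r')) + ind C (glue (fun _ => r) (glue (fun _ => 0) r'))
             - ind B (glue (fun _ => 0) (glue (fun _ => c) r')) * ind C (glue (fun _ => r) (glue (fun _ => 0) r')))))
      + (∑ q : Pd k, ∑ r' : Pd k, (if TotDist q r' = true then (1:ℤ) else 0) * (ind B (glue (fun _ => 0) (glue (fun _ => c) q))
          * ind C (glue (fun _ => r) (glue (fun _ => 0) r')) * (ind V q + ind V r' - ind V (thirdPt q r'))))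
      ≤ ∑ q : Pd k, d q * (ind B (glue (fun _ => 0) (glue (fun _ => c) q)) + ind C (glue (fun _ => r) (glue (fun _ => 0) q))) := by
    intro c r
    have hU1 : IsUpperSet (((sect (sect B (fun _ : Fin 1 => (0:Fin 3))) (fun _ : Fin 1 => c)) ∪ (sect (sect C (fun _ : Fin 1 => r)) (fun _ : Fin 1 => (0:Fin 3))) : Finset (Pd k)) : Set (Pd k)) := by
      rw [Finset.coe_union]; exact (hPup c).union (hQup r)
    have n1 := hN Finset.univ ((sect (sect B (fun _ : Fin 1 => (0:Fin 3))) (fun _ : Fin 1 => c)) ∪ (sect (sect C (fun _ : Fin 1 => r)) (fun _ : Fin 1 => (0:Fin 3)))) huniv hU1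
    have n2 := hN (sect (sect B (fun _ : Fin 1 => (0:Fin 3))) (fun _ : Fin 1 => c)) (sect (sect C (fun _ : Fin 1 => r)) (fun _ : Fin 1 => (0:Fin 3))) (hPup c) (hQup r)
    rw [Finset.univ_inter] at n1
    have e1 : (∑ q ∈ (Finset.univ : Finset (Pd k)), ∑ r' ∈ (sect (sect B (fun _ : Fin 1 => (0:Fin 3))) (fun _ : Fin 1 => c)) ∪ (sect (sect C (fun _ : Fin 1 => r)) (fun _ : Fin 1 => (0:Fin 3))), thetaVal V q r')
        = ∑ q : Pd k, ∑ r' : Pd k, (if TotDist q r' = true then (1:ℤ) else 0) * ((ind V q + ind V r' - ind V (thirdPt q r'))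
          * (ind B (glue (fun _ => 0) (glue (fun _ => c) r')) + ind C (glue (fun _ => r) (glue (fun _ => 0) r'))
             - ind B (glue (fun _ => 0) (glue (fun _ => c) r')) * ind C (glue (fun _ => r) (glue (fun _ => 0) r')))) := by
      refine Finset.sum_congr rfl fun q _ => ?_
      rw [sum_mem_eq_sum_ind_mul ((sect (sect B (fun _ : Fin 1 => (0:Fin 3))) (fun _ : Fin 1 => c)) ∪ (sect (sect C (fun _ : Fin 1 => r)) (fun _ : Fin 1 => (0:Fin 3))))]
      refine Finset.sum_congr rfl fun r' _ => ?_
      rw [ind_union_eq, hPind, hQind, thetaVal_eq_ite_mul]; ring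
    have e2 : (∑ q ∈ (sect (sect B (fun _ : Fin 1 => (0:Fin 3))) (fun _ : Fin 1 => c)), ∑ r' ∈ (sect (sect C (fun _ : Fin 1 => r)) (fun _ : Fin 1 => (0:Fin 3))), thetaVal V q r')
        = ∑ q : Pd k, ∑ r' : Pd k, (if TotDist q r' = true then (1:ℤ) else 0) * (ind B (glue (fun _ => 0) (glue (fun _ => c) q))
          * ind C (glue (fun _ => r) (glue (fun _ => 0) r')) * (ind V q + ind V r' - ind V (thirdPt q r'))) := by
      rw [sum_mem_eq_sum_ind_mul (sect (sect B (fun _ : Fin 1 => (0:Fin 3))) (fun _ : Fin 1 => c))]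
      refine Finset.sum_congr rfl fun q _ => ?_
      rw [sum_mem_eq_sum_ind_mul (sect (sect C (fun _ : Fin 1 => r)) (fun _ : Fin 1 => (0:Fin 3))), Finset.mul_sum]
      refine Finset.sum_congr rfl fun r' _ => ?_
      rw [hPind, hQind, thetaVal_eq_ite_mul]; ring
    have e3 : (∑ q ∈ (sect (sect B (fun _ : Fin 1 => (0:Fin 3))) (fun _ : Fin 1 => c)) ∪ (sect (sect C (fun _ : Fin 1 => r)) (fun _ : Fin 1 => (0:Fin 3))), d q) + (∑ q ∈ (sect (sect B (fun _ : Fin 1 => (0:Fin 3))) (fun _ : Fin 1 => c)) ∩ (sect (sect C (fun _ : Fin 1 => r)) (fun _ : Fin 1 => (0:Fin 3))), d q)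
        = ∑ q : Pd k, d q * (ind B (glue (fun _ => 0) (glue (fun _ => c) q)) + ind C (glue (fun _ => r) (glue (fun _ => 0) q))) := by
      rw [Finset.sum_union_inter, sum_mem_eq_sum_ind_mul (sect (sect B (fun _ : Fin 1 => (0:Fin 3))) (fun _ : Fin 1 => c)), sum_mem_eq_sum_ind_mul (sect (sect C (fun _ : Fin 1 => r)) (fun _ : Fin 1 => (0:Fin 3))), ← Finset.sum_add_distrib]
      refine Finset.sum_congr rfl fun q _ => ?_
      rw [hPind, hQind]; ring
    rw [← e1, ← e2, ← e3]
    linarith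
  have hD : ((∑ q : Pd k, ∑ r : Pd k, (if TotDist q r = true then (1:ℤ) else 0) * ((ind V q + ind V r - ind V (thirdPt q r)) * (ind B (glue (fun _ => 0) (glue (fun _ => 1) r)) + ind C (glue (fun _ => 1) (glue (fun _ => 0) r)) - ind B (glue (fun _ => 0) (glue (fun _ => 1) r)) * ind C (glue (fun _ => 1) (glue (fun _ => 0) r))))) + (∑ q : Pd k, ∑ r : Pd k, (if TotDist q r = true then (1:ℤ) else 0) * (ind B (glue (fun _ => 0) (glue (fun _ => 1) q)) * ind C (glue (fun _ => 1) (glue (fun _ => 0) r)) * (ind V q + ind V r - ind V (thirdPt q r))))) + ((∑ q : Pd k, ∑ r : Pd k, (if TotDist q r = true then (1:ℤ) else 0) * ((ind V q + ind V r - ind V (thirdPt q r)) * (ind B (glue (fun _ => 0) (glue (fun _ => 1) r)) + ind C (glue (fun _ => 2) (glue (fun _ => 0) r)) - ind B (glue (fun _ => 0) (glue (fun _ => 1) r)) * ind C (glue (fun _ => 2) (glue (fun _ => 0) r))))) + (∑ q : Pd k, ∑ r : Pd k, (if TotDist q r = true then (1:ℤ) else 0) * (ind B (glue (fun _ => 0)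 (glue (fun _ => 1) q)) * ind C (glue (fun _ => 2) (glue (fun _ => 0) r)) * (ind V q + ind V r - ind V (thirdPt q r))))) + ((∑ q : Pd k, ∑ r : Pd k, (if TotDist q r = true then (1:ℤ) else 0) * ((ind V q + ind V r - ind V (thirdPt q r)) * (ind B (glue (fun _ => 0) (glue (fun _ => 2) r)) + ind C (glue (fun _ => 1) (glue (fun _ => 0) r)) - ind B (glue (fun _ => 0) (glue (fun _ => 2) r)) * ind C (glue (fun _ => 1) (glue (fun _ => 0) r))))) + (∑ q : Pd k, ∑ r : Pd k, (if TotDist q r = true then (1:ℤ) else 0) * (ind B (glue (fun _ => 0) (glue (fun _ => 2) q)) * ind C (glue (fun _ => 1) (glue (fun _ => 0) r)) * (ind V q + ind V r - ind V (thirdPt q r))))) + ((∑ q : Pd k, ∑ r : Pd k, (if TotDist q r = true then (1:ℤ) else 0) * ((ind V q + ind V r - ind V (thirdPt q r)) * (ind B (glue (fun _ => 0) (glue (fun _ => 2) r)) + ind C (glue (fun _ => 2) (glue (fun _ => 0) r)) - ind B (glue (fun _ => 0) (glue (fun _ => 2) r)) * ind C (glue (fun _ => 2) (glue (fun _ =>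 0) r))))) + (∑ q : Pd k, ∑ r : Pd k, (if TotDist q r = true then (1:ℤ) else 0) * (ind B (glue (fun _ => 0) (glue (fun _ => 2) q)) * ind C (glue (fun _ => 2) (glue (fun _ => 0) r)) * (ind V q + ind V r - ind V (thirdPt q r)))))
      ≤ (∑ q : Pd k, 2 * d q * ind V q * (ind B (glue (fun _ => 0) (glue (fun _ => 1) q)) + ind B (glue (fun _ => 0) (glue (fun _ => 2) q)) + ind C (glue (fun _ => 1) (glue (fun _ => 0) q)) + ind C (glue (fun _ => 2) (glue (fun _ => 0) q)))) := by
    have s1 := cover 1 1; have s2 := cover 1 2; have s3 := cover 2 1; have s4 := cover 2 2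
    have eD : (∑ q : Pd k, 2 * d q * ind V q * (ind B (glue (fun _ => 0) (glue (fun _ => 1) q)) + ind B (glue (fun _ => 0) (glue (fun _ => 2) q)) + ind C (glue (fun _ => 1) (glue (fun _ => 0) q)) + ind C (glue (fun _ => 2) (glue (fun _ => 0) q))))
        = (∑ q : Pd k, d q * (ind B (glue (fun _ => 0) (glue (fun _ => 1) q)) + ind C (glue (fun _ => 1) (glue (fun _ => 0) q)))) + (∑ q : Pd k, d q * (ind B (glue (fun _ => 0) (glue (fun _ => 1) q)) + ind C (glue (fun _ => 2) (glue (fun _ => 0) q))))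
          + (∑ q : Pd k, d q * (ind B (glue (fun _ => 0) (glue (fun _ => 2) q)) + ind C (glue (fun _ => 1) (glue (fun _ => 0) q)))) + (∑ q : Pd k, d q * (ind B (glue (fun _ => 0) (glue (fun _ => 2) q)) + ind C (glue (fun _ => 2) (glue (fun _ => 0) q)))) := by
      rw [← Finset.sum_add_distrib, ← Finset.sum_add_distrib, ← Finset.sum_add_distrib]
      refine Finset.sum_congr rfl fun q _ => ?_
      rw [hdv2 q]; ring
    rw [eD]
    linarith [s1, s2, s3, s4]
  -- (4) the identity and the nonnegative columns
  obtain ⟨t1, t2, t3, t4⟩ := And.intro (fun q r => (thirdPt_cancel (k := k) q r).1) (And.intro (fun q r => (thirdPt_cancel (k := k) q r).2.1)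
    (And.intro (fun q r => (thirdPt_cancel (k := k) q r).2.2.1) (fun q r => (thirdPt_cancel (k := k) q r).2.2.2)))
  have Id := pairSum_eq_of_sym6_eq
    (fun q r => (((4 * ind V q * ind B (glue (fun _ => 0) (glue (fun _ => 0) q)) * ind C (glue (fun _ => 0) (glue (fun _ => 0) q)) + 2 * ind V q * (ind B (glue (fun _ => 0) (glue (fun _ => 1) q)) + ind B (glue (fun _ => 0) (glue (fun _ => 2) q)) + ind C (glue (fun _ => 1) (glue (fun _ => 0) q)) + ind C (glue (fun _ => 2) (glue (fun _ => 0) q))) + 16 + 12 * ind V q) - 12 * ind V r) - ( ind B (glue (fun _ => 0) (glue (fun _ => 0) q)) * (ind V q + 1 - 1)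
          + ind B (glue (fun _ => 0) (glue (fun _ => 0) q)) * (ind V q + 1 - 1)
          + ind B (glue (fun _ => 0) (glue (fun _ => 0) q)) * (ind V q + 1 - 1)
          + ind B (glue (fun _ => 0) (glue (fun _ => 0) q)) * (ind V q + 1 - 1)
          + ind B (glue (fun _ => 0) (glue (fun _ => 1) q)) * ind C (glue (fun _ => 1) (glue (fun _ => 0) r)) * (ind V q + ind V r - 1)
          + ind B (glue (fun _ => 0) (glue (fun _ => 1) q)) * (ind V q + 1 - ind V (thirdPt q r))
          + ind B (glue (fun _ => 0) (glue (fun _ => 1) q)) * ind C (glue (fun _ => 2) (glue (fun _ => 0) r)) * (ind V q + ind V r - 1)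
          + ind B (glue (fun _ => 0) (glue (fun _ => 1) q)) * (ind V q + 1 - ind V (thirdPt q r))
          + ind B (glue (fun _ => 0) (glue (fun _ => 2) q)) * ind C (glue (fun _ => 1) (glue (fun _ => 0) r)) * (ind V q + ind V r - 1)
          + ind B (glue (fun _ => 0) (glue (fun _ => 2) q)) * (ind V q + 1 - ind V (thirdPt q r))
          + ind B (glue (fun _ => 0) (glue (fun _ => 2) q)) * ind C (glue (fun _ => 2) (glue (fun _ => 0) r)) * (ind V q + ind V r - 1)
          + ind B (glue (fun _ => 0) (glue (fun _ => 2) q)) * (ind V q + 1 - ind V (thirdPt q r))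
          + (ind V q + ind V r - 1)
          + (ind V q + ind V r - 1)
          + (ind V q + 1 - ind V (thirdPt q r))
          + (ind V q + 1 - ind V (thirdPt q r))
          + ind C (glue (fun _ => 0) (glue (fun _ => 0) r)) * (1 + ind V r - 1)
          + (1 + ind V r - ind V (thirdPt q r))
          + ind C (glue (fun _ => 2) (glue (fun _ => 0) r)) * (1 + ind V r - ind V (thirdPt q r))
          + (1 + 1 - ind V (thirdPt q r))
          + ind C (glue (fun _ => 0) (glue (fun _ => 0) r)) * (1 + ind V r - 1)
          + (1 + ind V r - ind V (thirdPt q r))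
          + ind C (glue (fun _ => 2) (glue (fun _ => 0) r)) * (1 + ind V r - ind V (thirdPt q r))
          + (1 + 1 - ind V (thirdPt q r))
          + (ind V q + ind V r - 1)
          + (ind V q + ind V r - 1)
          + (ind V q + 1 - ind V (thirdPt q r))
          + (ind V q + 1 - ind V (thirdPt q r))
          + ind C (glue (fun _ => 0) (glue (fun _ => 0) r)) * (1 + ind V r - 1)
          + (1 + ind V r - ind V (thirdPt q r))
          + ind C (glue (fun _ => 1) (glue (fun _ => 0) r)) * (1 + ind V r - ind V (thirdPt q r))
          + (1 + 1 - ind V (thirdPt q r))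
          + ind C (glue (fun _ => 0) (glue (fun _ => 0) r)) * (1 + ind V r - 1)
          + (1 + ind V r - ind V (thirdPt q r))
          + ind C (glue (fun _ => 1) (glue (fun _ => 0) r)) * (1 + ind V r - ind V (thirdPt q r))
          + (1 + 1 - ind V (thirdPt q r)) )
        + ((ind V q + ind V r - ind V (thirdPt q r)) * (ind B (glue (fun _ => 0) (glue (fun _ => 1) r)) + ind C (glue (fun _ => 1) (glue (fun _ => 0) r)) - ind B (glue (fun _ => 0) (glue (fun _ => 1) r)) * ind C (glue (fun _ => 1) (glue (fun _ => 0) r))) + ind B (glue (fun _ => 0) (glue (fun _ => 1) q)) * ind C (glue (fun _ => 1) (glue (fun _ => 0) r)) * (ind V q + ind V r - ind V (thirdPt q r)) + (ind V q + ind V r - ind V (thirdPt q r)) * (ind B (glue (fun _ => 0) (glue (fun _ => 1) r)) + ind C (glue (fun _ => 2) (glue (fun _ => 0) r)) - ind B (glue (fun _ => 0) (glue (fun _ => 1) r)) * ind C (glue (fun _ => 2) (glue (fun _ => 0) r))) + ind B (glue (fun _ => 0) (glue (fun _ => 1) q)) * ind C (glue (fun _ => 2) (glue (fun _ => 0) r))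 * (ind V q + ind V r - ind V (thirdPt q r)) + (ind V q + ind V r - ind V (thirdPt q r)) * (ind B (glue (fun _ => 0) (glue (fun _ => 2) r)) + ind C (glue (fun _ => 1) (glue (fun _ => 0) r)) - ind B (glue (fun _ => 0) (glue (fun _ => 2) r)) * ind C (glue (fun _ => 1) (glue (fun _ => 0) r))) + ind B (glue (fun _ => 0) (glue (fun _ => 2) q)) * ind C (glue (fun _ => 1) (glue (fun _ => 0) r)) * (ind V q + ind V r - ind V (thirdPt q r)) + (ind V q + ind V r - ind V (thirdPt q r)) * (ind B (glue (fun _ => 0) (glue (fun _ => 2) r)) + ind C (glue (fun _ => 2) (glue (fun _ => 0) r)) - ind B (glue (fun _ => 0) (glue (fun _ => 2) r)) * ind C (glue (fun _ => 2) (glue (fun _ => 0) r))) + ind B (glue (fun _ => 0) (glue (fun _ => 2) q)) * ind C (glue (fun _ => 2) (glue (fun _ => 0) r)) * (ind V q + ind V r - ind V (thirdPt q r)))))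
    (fun q r => (1 - ind B (glue (fun _ => 0) (glue (fun _ => 1) q))) * (1 - ind C (glue (fun _ => 1) (glue (fun _ => 0) r))) * (1 - ind V (thirdPt q r)) + (1 - ind B (glue (fun _ => 0) (glue (fun _ => 1) q))) * (1 - ind C (glue (fun _ => 2) (glue (fun _ => 0) r))) * (1 - ind V (thirdPt q r)) + (1 - ind B (glue (fun _ => 0) (glue (fun _ => 2) q))) * (1 - ind C (glue (fun _ => 1) (glue (fun _ => 0) r))) * (1 - ind V (thirdPt q r)) + (1 - ind B (glue (fun _ => 0) (glue (fun _ => 2) q))) * (1 - ind C (glue (fun _ => 2) (glue (fun _ => 0) r))) * (1 - ind V (thirdPt q r)) + ind V q * (4 * (1 - ind B (glue (fun _ => 0) (glue (fun _ => 0) q))) * (1 - ind C (glue (fun _ => 0) (glue (fun _ => 0) q))) - (2 - ind B (glue (fun _ => 0) (glue (fun _ => 1) q)) - ind B (glue (fun _ => 0) (glue (fun _ => 2) q))) * (2 - ind C (glue (fun _ => 1) (glue (fun _ => 0) q)) - ind C (glue (fun _ => 2) (glue (fun _ => 0) q)))))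
    (fun q r => by simp only [t1, t2, t3, t4, thirdPt_comm r q]; ring)
  have hG : 0 ≤ ∑ q : Pd k, ∑ r : Pd k, (if TotDist q r = true then (1:ℤ) else 0) * ((1 - ind B (glue (fun _ => 0) (glue (fun _ => 1) q))) * (1 - ind C (glue (fun _ => 1) (glue (fun _ => 0) r))) * (1 - ind V (thirdPt q r)) + (1 - ind B (glue (fun _ => 0) (glue (fun _ => 1) q))) * (1 - ind C (glue (fun _ => 2) (glue (fun _ => 0) r))) * (1 - ind V (thirdPt q r)) + (1 - ind B (glue (fun _ => 0) (glue (fun _ => 2) q))) * (1 - ind C (glue (fun _ => 1) (glue (fun _ => 0) r))) * (1 - ind V (thirdPt q r)) + (1 - ind B (glue (fun _ => 0) (glue (fun _ => 2) q))) * (1 - ind C (glue (fun _ => 2) (glue (fun _ => 0) r))) * (1 - ind V (thirdPt q r)) + ind V q * (4 * (1 - ind B (glue (fun _ => 0) (glue (fun _ => 0) q))) * (1 - ind C (glue (fun _ => 0) (glue (fun _ => 0) q))) - (2 - ind B (glue (fun _ => 0) (glue (fun _ => 1) q)) - ind B (glue (fun _ => 0) (glue (fun _ => 2) q))) * (2 -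 ind C (glue (fun _ => 1) (glue (fun _ => 0) q)) - ind C (glue (fun _ => 2) (glue (fun _ => 0) q))))) := by
    have hle : ∀ (ξ η ξ' η' : Pd 1) (q : Pd k), ξ 0 ≤ ξ' 0 → η 0 ≤ η' 0 →
        ind B (glue ξ (glue η q)) ≤ ind B (glue ξ' (glue η' q)) := by
      intro ξ η ξ' η' q h1 h2
      have hle' : glue ξ (glue η q) ≤ glue ξ' (glue η' q) :=
        glue_le_glue_iff.2 ⟨fun i => by rw [Subsingleton.elim i 0]; exact h1, glue_le_glue_iff.2 ⟨fun i => by rw [Subsingleton.elim i 0]; exact h2, le_rfl⟩⟩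
      unfold ind
      by_cases hx : glue ξ (glue η q) ∈ B
      · rw [if_pos hx, if_pos (Finset.mem_coe.1 (hB hle' hx))]
      · rw [if_neg hx]; split_ifs <;> norm_num
    have hleC : ∀ (ξ η ξ' η' : Pd 1) (q : Pd k), ξ 0 ≤ ξ' 0 → η 0 ≤ η' 0 →
        ind C (glue ξ (glue η q)) ≤ ind C (glue ξ' (glue η' q)) := by
      intro ξ η ξ' η' q h1 h2
      have hle' : glue ξ (glue η q) ≤ glue ξ' (glue η' q) :=
        glue_le_glue_iff.2 ⟨fun i => by rw [Subsingleton.elim i 0]; exact h1, glue_le_glue_iff.2 ⟨fun i => by rw [Subsingleton.elim i 0]; exact h2, le_rfl⟩⟩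
      unfold ind
      by_cases hx : glue ξ (glue η q) ∈ C
      · rw [if_pos hx, if_pos (Finset.mem_coe.1 (hC hle' hx))]
      · rw [if_neg hx]; split_ifs <;> norm_num
    have f01 : (0:Fin 3) ≤ 1 := by decide
    have f02 : (0:Fin 3) ≤ 2 := by decide
    exact twoPayerCrossed_columns_nonneg (fun q => ind B (glue (fun _ => 0) (glue (fun _ => 0) q))) (fun q => ind B (glue (fun _ => 0) (glue (fun _ => 1) q))) (fun q => ind B (glue (fun _ => 0) (glue (fun _ => 2) q)))
      (fun q => ind C (glue (fun _ => 0) (glue (fun _ => 0) q))) (fun q => ind C (glue (fun _ => 1) (glue (fun _ => 0) q))) (fun q => ind C (glue (fun _ => 2) (glue (fun _ => 0) q))) (fun q => ind V q)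
      (fun q => ind_le_one' _ _) (fun q => ind_le_one' _ _) (fun q => ind_le_one' _ _) (fun q => ind_le_one' _ _)
      (fun q => ind_nonneg' _ _) (fun q => ind_le_one' _ _)
      (fun q => hle _ _ _ _ q le_rfl f01) (fun q => hle _ _ _ _ q le_rfl f02)
      (fun q => hleC _ _ _ _ q f01 le_rfl) (fun q => hleC _ _ _ _ q f02 le_rfl)
  -- (5) assemble
  have split : ((∑ q : Pd k, ∑ r : Pd k, (if TotDist q r = true then (1:ℤ) else 0) * ((4 * ind V q * ind B (glue (fun _ => 0) (glue (fun _ => 0) q)) * ind C (glue (fun _ => 0) (glue (fun _ => 0) q)) + 2 * ind V q * (ind B (glue (fun _ => 0) (glue (fun _ => 1) q)) + ind B (glue (fun _ => 0) (glue (fun _ => 2) q)) + ind C (glue (fun _ => 1) (glue (fun _ => 0) q)) + ind C (glue (fun _ => 2) (glue (fun _ => 0) q))) + 16 + 12 * ind V q) - 12 * ind V r))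
      - (∑ q : Pd k, ∑ r : Pd k, (if TotDist q r = true then (1:ℤ) else 0) * ( ind B (glue (fun _ => 0) (glue (fun _ => 0) q)) * (ind V q + 1 - 1)
          + ind B (glue (fun _ => 0) (glue (fun _ => 0) q)) * (ind V q + 1 - 1)
          + ind B (glue (fun _ => 0) (glue (fun _ => 0) q)) * (ind V q + 1 - 1)
          + ind B (glue (fun _ => 0) (glue (fun _ => 0) q)) * (ind V q + 1 - 1)
          + ind B (glue (fun _ => 0) (glue (fun _ => 1) q)) * ind C (glue (fun _ => 1) (glue (fun _ => 0) r)) * (ind V q + ind V r - 1)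
          + ind B (glue (fun _ => 0) (glue (fun _ => 1) q)) * (ind V q + 1 - ind V (thirdPt q r))
          + ind B (glue (fun _ => 0) (glue (fun _ => 1) q)) * ind C (glue (fun _ => 2) (glue (fun _ => 0) r)) * (ind V q + ind V r - 1)
          + ind B (glue (fun _ => 0) (glue (fun _ => 1) q)) * (ind V q + 1 - ind V (thirdPt q r))
          + ind B (glue (fun _ => 0) (glue (fun _ => 2) q)) * ind C (glue (fun _ => 1) (glue (fun _ => 0) r)) * (ind V q + ind V r - 1)
          + ind B (glue (fun _ => 0) (glue (fun _ => 2) q)) * (ind V q + 1 - ind V (thirdPt q r))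
          + ind B (glue (fun _ => 0) (glue (fun _ => 2) q)) * ind C (glue (fun _ => 2) (glue (fun _ => 0) r)) * (ind V q + ind V r - 1)
          + ind B (glue (fun _ => 0) (glue (fun _ => 2) q)) * (ind V q + 1 - ind V (thirdPt q r))
          + (ind V q + ind V r - 1)
          + (ind V q + ind V r - 1)
          + (ind V q + 1 - ind V (thirdPt q r))
          + (ind V q + 1 - ind V (thirdPt q r))
          + ind C (glue (fun _ => 0) (glue (fun _ => 0) r)) * (1 + ind V r - 1)
          + (1 + ind V r - ind V (thirdPt q r))
          + ind C (glue (fun _ => 2) (glue (fun _ => 0) r)) * (1 + ind V r - ind V (thirdPt q r))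
          + (1 + 1 - ind V (thirdPt q r))
          + ind C (glue (fun _ => 0) (glue (fun _ => 0) r)) * (1 + ind V r - 1)
          + (1 + ind V r - ind V (thirdPt q r))
          + ind C (glue (fun _ => 2) (glue (fun _ => 0) r)) * (1 + ind V r - ind V (thirdPt q r))
          + (1 + 1 - ind V (thirdPt q r))
          + (ind V q + ind V r - 1)
          + (ind V q + ind V r - 1)
          + (ind V q + 1 - ind V (thirdPt q r))
          + (ind V q + 1 - ind V (thirdPt q r))
          + ind C (glue (fun _ => 0) (glue (fun _ => 0) r)) * (1 + ind V r - 1)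
          + (1 + ind V r - ind V (thirdPt q r))
          + ind C (glue (fun _ => 1) (glue (fun _ => 0) r)) * (1 + ind V r - ind V (thirdPt q r))
          + (1 + 1 - ind V (thirdPt q r))
          + ind C (glue (fun _ => 0) (glue (fun _ => 0) r)) * (1 + ind V r - 1)
          + (1 + ind V r - ind V (thirdPt q r))
          + ind C (glue (fun _ => 1) (glue (fun _ => 0) r)) * (1 + ind V r - ind V (thirdPt q r))
          + (1 + 1 - ind V (thirdPt q r)) ))
      + (((∑ q : Pd k, ∑ r : Pd k, (if TotDist q r = true then (1:ℤ) else 0) * ((ind V q + ind V r - ind V (thirdPt q r)) * (ind B (glue (fun _ => 0) (glue (fun _ => 1) r)) + ind C (glue (fun _ => 1) (glue (fun _ => 0) r)) - ind B (glue (fun _ => 0) (glue (fun _ => 1) r)) * ind C (glue (fun _ => 1) (glue (fun _ => 0) r))))) + (∑ q : Pd k, ∑ r : Pd k, (if TotDist q r = true then (1:ℤ) else 0) * (ind B (glue (fun _ => 0) (glue (fun _ => 1) q)) * ind C (glue (fun _ => 1) (glue (fun _ => 0) r)) * (ind V q + ind V r - ind V (thirdPt q r))))) + ((∑ q : Pd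 k, ∑ r : Pd k, (if TotDist q r = true then (1:ℤ) else 0) * ((ind V q + ind V r - ind V (thirdPt q r)) * (ind B (glue (fun _ => 0) (glue (fun _ => 1) r)) + ind C (glue (fun _ => 2) (glue (fun _ => 0) r)) - ind B (glue (fun _ => 0) (glue (fun _ => 1) r)) * ind C (glue (fun _ => 2) (glue (fun _ => 0) r))))) + (∑ q : Pd k, ∑ r : Pd k, (if TotDist q r = true then (1:ℤ) else 0) * (ind B (glue (fun _ => 0) (glue (fun _ => 1) q)) * ind C (glue (fun _ => 2) (glue (fun _ => 0) r)) * (ind V q + ind V r - ind V (thirdPt q r))))) + ((∑ q : Pd k, ∑ r : Pd k, (if TotDist q r = true then (1:ℤ) else 0) * ((ind V q + ind V r - ind V (thirdPt q r)) * (ind B (glue (fun _ => 0) (glue (fun _ => 2) r)) + ind C (glue (fun _ => 1) (glue (fun _ => 0) r)) - ind B (glue (fun _ => 0) (glue (fun _ => 2) r)) * ind C (glue (fun _ => 1) (glue (fun _ => 0) r))))) + (∑ q : Pd k, ∑ r : Pd k, (if TotDist q r = true then (1:ℤ) else 0) * (ind B (glue (fun _ => 0) (glue (fun _ => 2) q))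 * ind C (glue (fun _ => 1) (glue (fun _ => 0) r)) * (ind V q + ind V r - ind V (thirdPt q r))))) + ((∑ q : Pd k, ∑ r : Pd k, (if TotDist q r = true then (1:ℤ) else 0) * ((ind V q + ind V r - ind V (thirdPt q r)) * (ind B (glue (fun _ => 0) (glue (fun _ => 2) r)) + ind C (glue (fun _ => 2) (glue (fun _ => 0) r)) - ind B (glue (fun _ => 0) (glue (fun _ => 2) r)) * ind C (glue (fun _ => 2) (glue (fun _ => 0) r))))) + (∑ q : Pd k, ∑ r : Pd k, (if TotDist q r = true then (1:ℤ) else 0) * (ind B (glue (fun _ => 0) (glue (fun _ => 2) q)) * ind C (glue (fun _ => 2) (glue (fun _ => 0) r)) * (ind V q + ind V r - ind V (thirdPt q r)))))))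
      = ∑ q : Pd k, ∑ r : Pd k, (if TotDist q r = true then (1:ℤ) else 0) * ((((4 * ind V q * ind B (glue (fun _ => 0) (glue (fun _ => 0) q)) * ind C (glue (fun _ => 0) (glue (fun _ => 0) q)) + 2 * ind V q * (ind B (glue (fun _ => 0) (glue (fun _ => 1) q)) + ind B (glue (fun _ => 0) (glue (fun _ => 2) q)) + ind C (glue (fun _ => 1) (glue (fun _ => 0) q)) + ind C (glue (fun _ => 2) (glue (fun _ => 0) q))) + 16 + 12 * ind V q) - 12 * ind V r) - ( ind B (glue (fun _ => 0) (glue (fun _ => 0) q)) * (ind V q + 1 - 1)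
          + ind B (glue (fun _ => 0) (glue (fun _ => 0) q)) * (ind V q + 1 - 1)
          + ind B (glue (fun _ => 0) (glue (fun _ => 0) q)) * (ind V q + 1 - 1)
          + ind B (glue (fun _ => 0) (glue (fun _ => 0) q)) * (ind V q + 1 - 1)
          + ind B (glue (fun _ => 0) (glue (fun _ => 1) q)) * ind C (glue (fun _ => 1) (glue (fun _ => 0) r)) * (ind V q + ind V r - 1)
          + ind B (glue (fun _ => 0) (glue (fun _ => 1) q)) * (ind V q + 1 - ind V (thirdPt q r))
          + ind B (glue (fun _ => 0) (glue (fun _ => 1) q)) * ind C (glue (fun _ => 2) (glue (fun _ => 0) r)) * (ind V q + ind V r - 1)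
          + ind B (glue (fun _ => 0) (glue (fun _ => 1) q)) * (ind V q + 1 - ind V (thirdPt q r))
          + ind B (glue (fun _ => 0) (glue (fun _ => 2) q)) * ind C (glue (fun _ => 1) (glue (fun _ => 0) r)) * (ind V q + ind V r - 1)
          + ind B (glue (fun _ => 0) (glue (fun _ => 2) q)) * (ind V q + 1 - ind V (thirdPt q r))
          + ind B (glue (fun _ => 0) (glue (fun _ => 2) q)) * ind C (glue (fun _ => 2) (glue (fun _ => 0) r)) * (ind V q + ind V r - 1)
          + ind B (glue (fun _ => 0) (glue (fun _ => 2) q)) * (ind V q + 1 - ind V (thirdPt q r))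
          + (ind V q + ind V r - 1)
          + (ind V q + ind V r - 1)
          + (ind V q + 1 - ind V (thirdPt q r))
          + (ind V q + 1 - ind V (thirdPt q r))
          + ind C (glue (fun _ => 0) (glue (fun _ => 0) r)) * (1 + ind V r - 1)
          + (1 + ind V r - ind V (thirdPt q r))
          + ind C (glue (fun _ => 2) (glue (fun _ => 0) r)) * (1 + ind V r - ind V (thirdPt q r))
          + (1 + 1 - ind V (thirdPt q r))
          + ind C (glue (fun _ => 0) (glue (fun _ => 0) r)) * (1 + ind V r - 1)
          + (1 + ind V r - ind V (thirdPt q r))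
          + ind C (glue (fun _ => 2) (glue (fun _ => 0) r)) * (1 + ind V r - ind V (thirdPt q r))
          + (1 + 1 - ind V (thirdPt q r))
          + (ind V q + ind V r - 1)
          + (ind V q + ind V r - 1)
          + (ind V q + 1 - ind V (thirdPt q r))
          + (ind V q + 1 - ind V (thirdPt q r))
          + ind C (glue (fun _ => 0) (glue (fun _ => 0) r)) * (1 + ind V r - 1)
          + (1 + ind V r - ind V (thirdPt q r))
          + ind C (glue (fun _ => 1) (glue (fun _ => 0) r)) * (1 + ind V r - ind V (thirdPt q r))
          + (1 + 1 - ind V (thirdPt q r))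
          + ind C (glue (fun _ => 0) (glue (fun _ => 0) r)) * (1 + ind V r - 1)
          + (1 + ind V r - ind V (thirdPt q r))
          + ind C (glue (fun _ => 1) (glue (fun _ => 0) r)) * (1 + ind V r - ind V (thirdPt q r))
          + (1 + 1 - ind V (thirdPt q r)) )
        + ((ind V q + ind V r - ind V (thirdPt q r)) * (ind B (glue (fun _ => 0) (glue (fun _ => 1) r)) + ind C (glue (fun _ => 1) (glue (fun _ => 0) r)) - ind B (glue (fun _ => 0) (glue (fun _ => 1) r)) * ind C (glue (fun _ => 1) (glue (fun _ => 0) r))) + ind B (glue (fun _ => 0) (glue (fun _ => 1) q)) * ind C (glue (fun _ => 1) (glue (fun _ => 0) r)) * (ind V q + ind V r - ind V (thirdPt q r)) + (ind V q + ind V r - ind V (thirdPt q r)) * (ind B (glue (fun _ => 0) (glue (fun _ => 1) r)) + ind C (glue (fun _ => 2) (glue (fun _ => 0) r)) - ind B (glue (fun _ => 0) (glue (fun _ => 1) r)) * ind C (glue (fun _ => 2) (glue (fun _ => 0) r))) + ind B (glue (fun _ => 0) (glue (fun _ => 1) q)) * ind C (glue (fun _ => 2) (glue (fun _ => 0) r))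 * (ind V q + ind V r - ind V (thirdPt q r)) + (ind V q + ind V r - ind V (thirdPt q r)) * (ind B (glue (fun _ => 0) (glue (fun _ => 2) r)) + ind C (glue (fun _ => 1) (glue (fun _ => 0) r)) - ind B (glue (fun _ => 0) (glue (fun _ => 2) r)) * ind C (glue (fun _ => 1) (glue (fun _ => 0) r))) + ind B (glue (fun _ => 0) (glue (fun _ => 2) q)) * ind C (glue (fun _ => 1) (glue (fun _ => 0) r)) * (ind V q + ind V r - ind V (thirdPt q r)) + (ind V q + ind V r - ind V (thirdPt q r)) * (ind B (glue (fun _ => 0) (glue (fun _ => 2) r)) + ind C (glue (fun _ => 2) (glue (fun _ => 0) r)) - ind B (glue (fun _ => 0) (glue (fun _ => 2) r)) * ind C (glue (fun _ => 2) (glue (fun _ => 0) r))) + ind B (glue (fun _ => 0) (glue (fun _ => 2) q)) * ind C (glue (fun _ => 2) (glue (fun _ => 0) r)) * (ind V q + ind V r - ind V (thirdPt q r))))) := by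
    simp only [← Finset.sum_add_distrib, ← Finset.sum_sub_distrib]
    refine Finset.sum_congr rfl fun q _ => Finset.sum_congr rfl fun r _ => ?_
    ring
  rw [hE]
  linarith [hD, Id, hG, split]

end Summit.CriticalPhenomena.PercolationContinuityZ3.Theorems.SahiGridPattern
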